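import Mathlib
import HarnessLib
import Summits.NavierStokesRegularity.NavierStokesRegularity.Theorems.UnthreadedRigidityDoorUnthreadedRigidityVirialHornAngularTwo
import Summits.NavierStokesRegularity.NavierStokesRegularity.Theorems.UnthreadedRigidityDoorUnthreadedRigidityVirialHornAngularJets
import Summits.NavierStokesRegularity.NavierStokesRegularity.Theorems.UnthreadedRigidityDoorUnthreadedRigidityVirialHornOrderTwoBracket
import Summits.NavierStokesRegularity.NavierStokesRegularity.Theorems.UnthreadedRigidityDoorUnthreadedRigidityVirialHornAngularFrame
import Summits.NavierStokesRegularity.NavierStokesRegularity.Theorems.UnthreadedRigidityDoorUnthreadedRigidityThreadingJetsVirialFields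

/-!
# Route `UnthreadedRigidityDoor`, wall item W2 `UnthreadedRigidity` (stmt-NavierStokesRegularity-27585) — LINE g13-1 «SPECTRAL EDGE»
# (ns-idea-6 g13, `SpectralEdge_sketch.lean` 063ba262cce6adae; idea-crit-7 PASS B with price; DIRECTOR-NS #303 (A)): obligation O-ID2
# `EdgeProportional 2 22`, VERBATIM (the sketch-local `edgeForm` / `hessSq` / `gradSq` unfolded)

Seat ns-es-p1 g9 (W2 second queue).  THE IDENTITY: on the degree-two solid harmonics `V₂` the (self-)edge form of the line,
`𝔅_l[Y] = Δ{Y,|∇Y|²} − (4l² − 20l + 6)·{Y,|∇Y|²} − 2·{Y, |Hess Y|² − 2(l−1)²|∇Y|²}` at `l = 2`, equals `22·{Y,|∇Y|²}` (at every point, not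
only on `S²`).  With the sketch's `edgeAngularLemma_two` and the tree's `angularLemma_holds` this closes E1 at `l = 2`: every non-zonal degree-2
Bessel shell threads at order `ε³`; ★ `edgeAngularLemma_two : «EdgeAngularLemma 2»` VERBATIM is derived here (§4) from the
identity, the cone property of `{Y,|∇Y|²}` (`ThreadingJets.angForm_smul`) and the tree's `angularLemma_two`.

PROOF (frame-free; the ideator certified it by exact grid interpolation, `EDGE_l2cert.py`).  Write `Y = Y_Q` with `Q` symmetric
(`exists_quadY_of_isHomogeneous_two`).  The gradient `∇Y = 2Qy` is LINEAR (`gradient_quadY`), so the Hessian field is the CONSTANT operator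
`G : w ↦ 2Qw`; hence `|Hess Y|²` is constant and `{Y, |Hess Y|² − 2|∇Y|²} = −2{Y,|∇Y|²}` (`pbr_sub`, `pbr_const_mul`), contributing `+4·{Y,|∇Y|²}`;
`−(4·4 − 40 + 6) = +18`; and `Δ{Y,|∇Y|²} = 0`: by `angForm_eq`, `{Y,|∇Y|²}(z) = 2⟪z × Gz, G(Gz)⟫`, whose second derivative along `v` is
`4(⟪v × Gv, G²z⟫ + ⟪v × Gz, G²v⟫ + ⟪z × Gv, G²v⟫)`; summed over `v = e₀, e₁, e₂` each of the three sums is the axial vector of the antisymmetric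
part of `G`, `G²`, `G³` paired with something — zero because `Q` is symmetric (`lap3_angForm_quadY`).  Total `0 + 18 + 4 = 22`.

HONEST LABEL: a finite polynomial identity supporting a files-only RUNG line two levels below W2 (K2 of g12-4's perturbative sector); nothing here
bears on `UnthreadedRigidity` (27585), the door Target, W2 or Navier–Stokes regularity; no summit statement is proved.  0 kit.  [folklore]
-/

noncomputable section

-- the summit and its single sub-problem share the name (CONVENTIONS §1), as in every Theorems file
set_option linter.dupNamespace false

namespace Summit.NavierStokesRegularity.NavierStokesRegularity.Theorems.UnthreadedRigidity.SpectralEdge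

open Set Function Filter Topology
open scoped RealInnerProductSpace
open Literature.Analysis.FluidPDE (cross crossCLM hasFDerivAt_cross)
open Summit.NavierStokesRegularity.NavierStokesRegularity.Theorems.UnthreadedRigidity.ProfileHorn (E3 quadY)
open Summit.NavierStokesRegularity.NavierStokesRegularity.Theorems.UnthreadedRigidity.VirialHorn

/-! ## §1 The constant Hessian of a quadratic form -/

/-- the linear operator `w ↦ 2Qw` on `ℝ³` exists as a continuous linear map (the gradient map / constant Hessian of `Y_Q`); stated as an
existence theorem so that no definition is introduced. [folklore] -/
theorem exists_hessOp (Q : Matrix (Fin 3) (Fin 3) ℝ) :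
    ∃ G : E3 →L[ℝ] E3, ∀ (w : E3) (i : Fin 3), G w i = 2 * ∑ j : Fin 3, Q i j * w j :=
  ⟨LinearMap.toContinuousLinearMap
    { toFun := fun w => WithLp.toLp 2 fun i => 2 * ∑ j : Fin 3, Q i j * w j
      map_add' := fun a b => by
        ext i
        simp only [PiLp.add_apply, mul_add, Finset.sum_add_distrib]
      map_smul' := fun c a => by
        ext i
        simp only [PiLp.smul_apply, smul_eq_mul, RingHom.id_apply, Finset.mul_sum]
        refine Finset.sum_congr rfl fun j _ => ?_
        ring }, fun _ _ => rfl⟩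

/-- for symmetric `Q` the gradient of `Y_Q` IS the operator `w ↦ 2Qw`. -/
theorem gradient_quadY_eq_op {Q : Matrix (Fin 3) (Fin 3) ℝ} (hQ : Q.IsSymm) {G : E3 →L[ℝ] E3}
    (hG : ∀ (w : E3) (i : Fin 3), G w i = 2 * ∑ j : Fin 3, Q i j * w j) : gradient (quadY Q) = ⇑G := by
  rw [gradient_quadY hQ]
  funext w
  ext i
  rw [PiLp.toLp_apply, hG]

/-- the Hessian field of `Y_Q` is the constant operator `w ↦ 2Qw`. -/
theorem fderiv_gradient_quadY_eq_op {Q : Matrix (Fin 3) (Fin 3) ℝ} (hQ : Q.IsSymm) {G : E3 →L[ℝ] E3}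
    (hG : ∀ (w : E3) (i : Fin 3), G w i = 2 * ∑ j : Fin 3, Q i j * w j) (z : E3) :
    fderiv ℝ (gradient (quadY Q)) z = G := by
  rw [gradient_quadY_eq_op hQ hG]
  exact G.fderiv

/-! ## §2 `Δ{Y_Q,|∇Y_Q|²} = 0` -/

/-- a component of the cross product (private copy). -/
private theorem cross_apply_zero' (u v : E3) : cross u v 0 = u 1 * v 2 - u 2 * v 1 := by
  simp [cross, cross_apply]

/-- a component of the cross product (private copy). -/
private theorem cross_apply_one' (u v : E3) : cross u v 1 = u 2 * v 0 - u 0 * v 2 := by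
  simp [cross, cross_apply]

/-- a component of the cross product (private copy). -/
private theorem cross_apply_two' (u v : E3) : cross u v 2 = u 0 * v 1 - u 1 * v 0 := by
  simp [cross, cross_apply]

/-- the inner product in coordinates (private copy). -/
private theorem real_inner_e3' (u v : E3) : ⟪u, v⟫ = u 0 * v 0 + u 1 * v 1 + u 2 * v 2 := by
  simp [PiLp.inner_apply, Fin.sum_univ_three, mul_comm]

/-- THE SECOND DIRECTIONAL DERIVATIVE of `T(z) = ⟪z × Gz, G(Gz)⟫` (`G` a fixed operator) along `v`, twice:
`D²T(z)(v,v) = 2(⟪v × Gv, G²z⟫ + ⟪v × Gz, G²v⟫ + ⟪z × Gv, G²v⟫)`. [folklore] -/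
theorem dir2_inner_cross_op (G : E3 →L[ℝ] E3) (v z : E3) :
    dir2 (fun w : E3 => ⟪cross w (G w), G (G w)⟫) v z =
      2 * (⟪cross v (G v), G (G z)⟫ + ⟪cross v (G z), G (G v)⟫ + ⟪cross z (G v), G (G v)⟫) := by
  -- first derivative at every point
  have hR : ∀ w : E3, HasFDerivAt (fun w : E3 => cross w (G w))
      (crossCLM.precompR E3 w G + crossCLM.precompL E3 (ContinuousLinearMap.id ℝ E3) (G w)) w :=
    fun w => hasFDerivAt_cross (hasFDerivAt_id w) G.hasFDerivAt
  have hS : ∀ w : E3, HasFDerivAt (fun w : E3 => G (G w)) (G.comp G) w := fun w => G.hasFDerivAt.comp w G.hasFDerivAt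
  have hT : ∀ w : E3, HasFDerivAt (fun w : E3 => ⟪cross w (G w), G (G w)⟫)
      ((fderivInnerCLM ℝ (cross w (G w), G (G w))).comp
        ((crossCLM.precompR E3 w G + crossCLM.precompL E3 (ContinuousLinearMap.id ℝ E3) (G w)).prod (G.comp G))) w :=
    fun w => (hR w).inner ℝ (hS w)
  have hfirst : (fun w : E3 => fderiv ℝ (fun w : E3 => ⟪cross w (G w), G (G w)⟫) w v) =
      fun w : E3 => ⟪cross w (G w), G (G v)⟫ + (⟪cross w (G v), G (G w)⟫ + ⟪cross v (G w), G (G w)⟫) := by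
    funext w
    rw [(hT w).fderiv]
    simp only [ContinuousLinearMap.comp_apply, ContinuousLinearMap.prod_apply, fderivInnerCLM_apply, _root_.add_apply,
      ContinuousLinearMap.precompR_apply, ContinuousLinearMap.compL_apply, ContinuousLinearMap.precompL_apply, Literature.Analysis.FluidPDE.crossCLM_apply,
      ContinuousLinearMap.id_apply, inner_add_left]
  -- second derivative
  unfold dir2
  rw [hfirst]
  have h1 : HasFDerivAt (fun w : E3 => ⟪cross w (G w), G (G v)⟫)
      ((fderivInnerCLM ℝ (cross z (G z), G (G v))).comp
        ((crossCLM.precompR E3 z G + crossCLM.precompL E3 (ContinuousLinearMap.id ℝ E3) (G z)).prod 0)) z :=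
    (hR z).inner ℝ (hasFDerivAt_const (G (G v)) z)
  have h2 : HasFDerivAt (fun w : E3 => ⟪cross w (G v), G (G w)⟫)
      ((fderivInnerCLM ℝ (cross z (G v), G (G z))).comp
        ((crossCLM.precompR E3 z (0 : E3 →L[ℝ] E3) + crossCLM.precompL E3 (ContinuousLinearMap.id ℝ E3) (G v)).prod (G.comp G))) z :=
    (hasFDerivAt_cross (hasFDerivAt_id z) (hasFDerivAt_const (G v) z)).inner ℝ (hS z)
  have h3 : HasFDerivAt (fun w : E3 => ⟪cross v (G w), G (G w)⟫)
      ((fderivInnerCLM ℝ (cross v (G z), G (G z))).comp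
        ((crossCLM.precompR E3 v G + crossCLM.precompL E3 (0 : E3 →L[ℝ] E3) (G z)).prod (G.comp G))) z :=
    (hasFDerivAt_cross (hasFDerivAt_const v z) G.hasFDerivAt).inner ℝ (hS z)
  have h123 : HasFDerivAt (fun w : E3 => ⟪cross w (G w), G (G v)⟫ + (⟪cross w (G v), G (G w)⟫ + ⟪cross v (G w), G (G w)⟫))
      ((fderivInnerCLM ℝ (cross z (G z), G (G v))).comp
        ((crossCLM.precompR E3 z G + crossCLM.precompL E3 (ContinuousLinearMap.id ℝ E3) (G z)).prod 0)
      + ((fderivInnerCLM ℝ (cross z (G v), G (G z))).comp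
        ((crossCLM.precompR E3 z (0 : E3 →L[ℝ] E3) + crossCLM.precompL E3 (ContinuousLinearMap.id ℝ E3) (G v)).prod (G.comp G))
      + (fderivInnerCLM ℝ (cross v (G z), G (G z))).comp
        ((crossCLM.precompR E3 v G + crossCLM.precompL E3 (0 : E3 →L[ℝ] E3) (G z)).prod (G.comp G)))) z :=
    h1.add (h2.add h3)
  rw [h123.fderiv]
  simp only [ContinuousLinearMap.comp_apply, ContinuousLinearMap.prod_apply, fderivInnerCLM_apply, _root_.add_apply,
    ContinuousLinearMap.precompR_apply, ContinuousLinearMap.compL_apply, ContinuousLinearMap.precompL_apply, Literature.Analysis.FluidPDE.crossCLM_apply,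
    ContinuousLinearMap.id_apply, _root_.zero_apply, inner_add_left, inner_zero_right]
  -- `w × 0 = 0`
  have hz0 : ∀ w : E3, cross w (0 : E3) = 0 := fun w => by
    ext i; fin_cases i <;> simp [cross]
  have h0z : ∀ w : E3, cross (0 : E3) w = 0 := fun w => by
    ext i; fin_cases i <;> simp [cross]
  simp only [hz0, h0z, inner_zero_left, add_zero, zero_add]
  ring

/-- ★ THE ANGULAR FORM OF A QUADRATIC HARMONIC IS HARMONIC: `Δ{Y_Q,|∇Y_Q|²} = 0` for symmetric `Q` (each of the three sums
`Σᵢ eᵢ × G eᵢ`, `Σᵢ ⟪eᵢ × Gz, G²eᵢ⟫`, `Σᵢ Geᵢ × G²eᵢ` is an antisymmetrisation of a symmetric operator). [folklore] -/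
theorem lap3_angForm_quadY {Q : Matrix (Fin 3) (Fin 3) ℝ} (hQ : Q.IsSymm) (z : E3) : lap3 (angForm (quadY Q)) z = 0 := by
  have hs : ∀ i j : Fin 3, Q j i = Q i j := fun i j => by
    have := congrFun (congrFun hQ i) j
    simpa [Matrix.transpose_apply] using this
  -- `angForm (quadY Q) = 2 · T` with `T(w) = ⟪w × Gw, G(Gw)⟫`, `G = (w ↦ 2Qw)`
  obtain ⟨G, hG⟩ := exists_hessOp Q
  have hA : angForm (quadY Q) = fun w : E3 => 2 * ⟪cross w (G w), G (G w)⟫ := by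
    funext w
    unfold angForm pbr
    have hgrad : gradient (quadY Q) w = G w := by rw [gradient_quadY_eq_op hQ hG]
    have hN : gradient (fun x : E3 => ‖gradient (quadY Q) x‖ ^ 2) w = (2 : ℝ) • G (G w) := by
      have h := (hasGradientAt_norm_gradient_quadY_sq hQ w).gradient
      rw [h]
      ext i
      simp only [PiLp.smul_apply, smul_eq_mul, hG, Fin.sum_univ_three, hs]
      ring
    rw [hgrad, hN, det3_smul_right, det3_eq_inner_cross_left]
  -- the Laplacian of `2 · T`
  have hT2 : ∀ v : E3, dir2 (fun w : E3 => 2 * ⟪cross w (G w), G (G w)⟫) v z =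
      2 * dir2 (fun w : E3 => ⟪cross w (G w), G (G w)⟫) v z := by
    intro v
    -- differentiability of `T` and of its first derivative (both polynomial)
    have hR : ∀ w : E3, HasFDerivAt (fun w : E3 => cross w (G w))
        (crossCLM.precompR E3 w G + crossCLM.precompL E3 (ContinuousLinearMap.id ℝ E3) (G w)) w :=
      fun w => hasFDerivAt_cross (hasFDerivAt_id w) G.hasFDerivAt
    have hS : ∀ w : E3, HasFDerivAt (fun w : E3 => G (G w)) (G.comp G) w := fun w => G.hasFDerivAt.comp w G.hasFDerivAt
    have hTd : ∀ w : E3, DifferentiableAt ℝ (fun w : E3 => ⟪cross w (G w), G (G w)⟫) w :=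
      fun w => ((hR w).inner ℝ (hS w)).differentiableAt
    have hfirst : (fun w : E3 => fderiv ℝ (fun w : E3 => 2 * ⟪cross w (G w), G (G w)⟫) w v) =
        fun w : E3 => 2 * fderiv ℝ (fun w : E3 => ⟪cross w (G w), G (G w)⟫) w v := by
      funext w
      rw [fderiv_const_mul (hTd w)]
      rfl
    unfold dir2
    rw [hfirst]
    -- the first derivative is differentiable (explicit polynomial form from `dir2_inner_cross_op`'s proof)
    have hT : ∀ w : E3, HasFDerivAt (fun w : E3 => ⟪cross w (G w), G (G w)⟫)
        ((fderivInnerCLM ℝ (cross w (G w), G (G w))).comp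
          ((crossCLM.precompR E3 w G + crossCLM.precompL E3 (ContinuousLinearMap.id ℝ E3) (G w)).prod (G.comp G))) w :=
      fun w => (hR w).inner ℝ (hS w)
    have hf1 : (fun w : E3 => fderiv ℝ (fun w : E3 => ⟪cross w (G w), G (G w)⟫) w v) =
        fun w : E3 => ⟪cross w (G w), G (G v)⟫ + (⟪cross w (G v), G (G w)⟫ + ⟪cross v (G w), G (G w)⟫) := by
      funext w
      rw [(hT w).fderiv]
      simp only [ContinuousLinearMap.comp_apply, ContinuousLinearMap.prod_apply, fderivInnerCLM_apply, _root_.add_apply,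
        ContinuousLinearMap.precompR_apply, ContinuousLinearMap.compL_apply, ContinuousLinearMap.precompL_apply, Literature.Analysis.FluidPDE.crossCLM_apply,
        ContinuousLinearMap.id_apply, inner_add_left]
    have hd1 : DifferentiableAt ℝ (fun w : E3 => fderiv ℝ (fun w : E3 => ⟪cross w (G w), G (G w)⟫) w v) z := by
      rw [hf1]
      have h1 : DifferentiableAt ℝ (fun w : E3 => ⟪cross w (G w), G (G v)⟫) z :=
        ((hR z).inner ℝ (hasFDerivAt_const (G (G v)) z)).differentiableAt
      have h2 : DifferentiableAt ℝ (fun w : E3 => ⟪cross w (G v), G (G w)⟫) z :=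
        ((hasFDerivAt_cross (hasFDerivAt_id z) (hasFDerivAt_const (G v) z)).inner ℝ (hS z)).differentiableAt
      have h3 : DifferentiableAt ℝ (fun w : E3 => ⟪cross v (G w), G (G w)⟫) z :=
        ((hasFDerivAt_cross (hasFDerivAt_const v z) G.hasFDerivAt).inner ℝ (hS z)).differentiableAt
      exact h1.add (h2.add h3)
    rw [fderiv_const_mul hd1]
    rfl
  unfold lap3
  rw [hA]
  simp only [hT2, dir2_inner_cross_op]
  -- coordinates: every term is a polynomial in the entries of `Q` and `z`; symmetry of `Q` kills the sum
  simp only [Fin.sum_univ_three, real_inner_e3', cross_apply_zero', cross_apply_one', cross_apply_two', hG]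
  simp [e, hs]
  ring

/-! ## §3 ★ `EdgeProportional 2 22`, VERBATIM -/

/-- ★ **Obligation O-ID2 of LINE g13-1 — `EdgeProportional 2 22` VERBATIM** (the sketch-local `edgeForm 2`, `hessSq`, `gradSq` unfolded): on every
degree-two solid harmonic the edge form is `22 ×` the angular form, at every point (module docstring for the proof). -/
theorem edgeProportional_two :
    ∀ Y : E3 → ℝ, IsSolidHarmonic 2 Y → ∀ y : E3, ‖y‖ = 1 →
      lap3 (angForm Y) y - (4 * ((2 : ℕ) : ℝ) ^ 2 - 20 * ((2 : ℕ) : ℝ) + 6) * angForm Y y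
        - 2 * pbr Y (fun z => (∑ i : Fin 3, ‖fderiv ℝ (gradient Y) z (e i)‖ ^ 2)
            - 2 * (((2 : ℕ) : ℝ) - 1) ^ 2 * ‖gradient Y z‖ ^ 2) y
      = 22 * angForm Y y := by
  intro Y hY y _
  -- `Y = Y_Q`, `Q` symmetric
  have hY' := hY
  obtain ⟨⟨P, hPh, hPe⟩, -⟩ := hY'
  obtain ⟨Q, hQs, hQe⟩ := exists_quadY_of_isHomogeneous_two P hPh
  have hYQ : Y = quadY Q := funext fun y => (hPe y).trans (hQe y)
  subst hYQ
  have hYh : IsSolidHarmonic 2 (quadY Q) := hY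
  -- the Hessian term is constant
  obtain ⟨G, hG⟩ := exists_hessOp Q
  have hconst : (fun z : E3 => (∑ i : Fin 3, ‖fderiv ℝ (gradient (quadY Q)) z (e i)‖ ^ 2)
        - 2 * (((2 : ℕ) : ℝ) - 1) ^ 2 * ‖gradient (quadY Q) z‖ ^ 2) =
      fun z : E3 => (∑ i : Fin 3, ‖G (e i)‖ ^ 2) - 2 * ‖gradient (quadY Q) z‖ ^ 2 := by
    funext z
    rw [fderiv_gradient_quadY_eq_op hQs hG z]
    push_cast
    ring
  have hGn : Differentiable ℝ (fun z : E3 => ‖gradient (quadY Q) z‖ ^ 2) :=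
    (hYh.contDiff_gradient.differentiable (by simp)).norm_sq ℝ
  have hpbr : pbr (quadY Q) (fun z : E3 => (∑ i : Fin 3, ‖fderiv ℝ (gradient (quadY Q)) z (e i)‖ ^ 2)
        - 2 * (((2 : ℕ) : ℝ) - 1) ^ 2 * ‖gradient (quadY Q) z‖ ^ 2) y = -2 * angForm (quadY Q) y := by
    rw [hconst, pbr_sub (quadY Q) (differentiableAt_const _) ((hGn y).const_mul _), pbr_const_mul (quadY Q) _ (hGn y)]
    have h0 : pbr (quadY Q) (fun _ : E3 => ∑ i : Fin 3, ‖G (e i)‖ ^ 2) y = 0 := by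
      unfold pbr
      rw [gradient_fun_const]
      simp [det3]
    rw [h0]
    unfold angForm
    ring
  rw [hpbr, lap3_angForm_quadY hQs y]
  push_cast
  ring

/-! ## §4 ★ E1 at `l = 2`: `EdgeAngularLemma 2`, VERBATIM -/

/-- ★ **E1₂ — the sketch's `EdgeAngularLemma 2` VERBATIM** (sketch-local `edgeForm` / `hessSq` / `gradSq` unfolded): a degree-two solid harmonic whose
edge form vanishes on the unit sphere is ZONAL.  (`edgeProportional_two`: the edge form is `22·{Y,|∇Y|²}` there, so `{Y,|∇Y|²} = 0` on `S²`, hence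
everywhere by homogeneity (`ThreadingJets.angForm_smul`), and the tree's degree-two angular lemma `angularLemma_two` applies.)  This is the sketch's
`edgeAngularLemma_two hP` with its hypothesis `hP : EdgeProportional 2 22` discharged. -/
theorem edgeAngularLemma_two :
    ∀ Y : E3 → ℝ, IsSolidHarmonic 2 Y →
      (∀ y : E3, ‖y‖ = 1 →
        lap3 (angForm Y) y - (4 * ((2 : ℕ) : ℝ) ^ 2 - 20 * ((2 : ℕ) : ℝ) + 6) * angForm Y y
          - 2 * pbr Y (fun z => (∑ i : Fin 3, ‖fderiv ℝ (gradient Y) z (e i)‖ ^ 2)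
              - 2 * (((2 : ℕ) : ℝ) - 1) ^ 2 * ‖gradient Y z‖ ^ 2) y = 0) →
      IsZonal Y := by
  intro Y hY hE
  -- `{Y,|∇Y|²} = 0` on the unit sphere
  have hS : ∀ u : E3, ‖u‖ = 1 → angForm Y u = 0 := by
    intro u hu
    have h := edgeProportional_two Y hY u hu
    rw [hE u hu] at h
    linarith
  -- hence everywhere (cone property)
  have hA : ∀ y : E3, angForm Y y = 0 := by
    intro y
    rcases eq_or_ne y 0 with hy | hy
    · subst hy
      simp [angForm, pbr, det3]
    · have hn : 0 < ‖y‖ := norm_pos_iff.2 hy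
      set u : E3 := (1 / ‖y‖) • y with hu
      have hun : ‖u‖ = 1 := by
        rw [hu, norm_smul, Real.norm_eq_abs, abs_div, abs_one, abs_of_nonneg (norm_nonneg _), one_div_mul_cancel hn.ne']
      have hyu : y = ‖y‖ • u := by rw [hu, smul_smul, mul_one_div_cancel hn.ne', one_smul]
      rw [hyu, ThreadingJets.angForm_smul hY hn u, hS u hun, mul_zero]
  exact angularLemma_two Y hY hA

end Summit.NavierStokesRegularity.NavierStokesRegularity.Theorems.UnthreadedRigidity.SpectralEdge

end
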